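import Summits.ValiantsHypothesis.ValiantsHypothesis.Theses.MonotoneRestoration
import Literature.Computability.AlgebraicComplexity.ArithCircuitProofs

/-!
# Disproof of `MonotoneRestorationQP` — findings (cdisprove, cycle 1)

Crux `stmt-ValiantsHypothesis-15886` = `MonotoneRestoration.MonotoneRestorationQP`:
every MATRIX-SYMMETRIC family `f n ∈ ℝ≥0[x_ij]` (invariant under independent row/column
permutations) of polynomial degree and polynomial MONOTONE complexity (tree `complexity` over the
semiring `ℝ≥0`) has square-symmetric circuits over `ℂ` of size `2^((log₂ n + c')^c')`.

Findings of this file (all sorry-free; LANDED in the tree under `Theorems/MonotoneRestorationQP/Negative/`: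
`LoadBearing.lean` = p129549, `UniformExponentFalse.lean` = p129604, both ACCEPTED 2026-08-16):

* (a) LOAD-BEARING ANALYSIS.
  - `monotoneRestorationQP_false_without_complexity` : dropping the monotone-complexity bound is
    FALSE — witness the nonnegative permanent (matrix-symmetric, degree `n`), by Dawar–Wilsenach
    Thm 7.1 (`DawarWilsenach2025_thm71_holds`, PROVED in the tree). Any proof must use the
    complexity hypothesis (of course) — but note the witness is the permanent itself, i.e. the
    ONLY separating information the route has is "per is monotone-hard" (Jerrum–Snir).
  - `monotoneRestorationQP_false_without_invariance` : dropping matrix symmetry is FALSE —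
    a square-symmetric circuit computes a diagonally invariant polynomial
    (`IsSymmetric.rename_eval_output_unit`), and `x₀₁` (monotone complexity 0) is not.
    SOFT SPOT recorded, not refuted: the conclusion only needs DIAGONAL invariance
    (`x_ij ↦ x_{σ i, σ j}`); the crux assumes the larger group `S_n × S_n`. The diagonal-only
    strengthening `MonotoneRestorationQPDiag` is stated below; no counterexample is known
    (candidates: order-exploiting DPs on directed graphs — none found with counting width > 3).
  - degree bound: NOT refuted when dropped; believed unnecessary given the complexity bound
    (repeated squaring is symmetric-simulable: a product gate with children `{g, copy g}`).
* (c) NATURAL STRENGTHENINGS.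
  - `not_monotoneRestorationQPUniform` : the quantifier swap `∃ c', ∀ f` is FALSE — at `n = 1`
    the family `(Σ x_ij)^(3^c)` has monotone complexity `O(3^c n²)` but every labelled circuit with
    `s` gates has degree `≤ s^s` (`totalDegree_eval_le`), so no uniform `c'` serves all `c`.
    (Information for provers: `c'` must grow with the monotone exponent `c`; the degree-growth
    lemma `totalDegree_eval_le` is the only size lower bound for `LabelledArithCircuit` in the
    tree besides DW Thm 7.1.)
* WHY IT RESISTS (no kill): see the docstring of `resists` at the end — every order-exploiting
  monotone DP we could write down evaluates, on 0/1 matrices, to a function of the C²/C³-type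
  (degree multisets, codegree matrices), hence has counting width ≤ 3 and restores; the known
  sources of large counting width (#PM on CFI pairs, XOR-unsatisfiability, rank mod p) are
  monotone-HARD (Jerrum–Snir 1982 §4.3; Göös–Kamath–Robere–Sokolov 2019 Thm 1), so the DW 6.4
  bridge cannot be fed.
-/

set_option linter.dupNamespace false

namespace Summit.ValiantsHypothesis.ValiantsHypothesis.Cruxes.MonotoneRestorationQP.Disproof

open Literature.Computability.AlgebraicComplexity MvPolynomial
open Summit.ValiantsHypothesis.ValiantsHypothesis.Theses.MonotoneRestoration (MonotoneRestorationQP)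

noncomputable section

/-! ### The pieces of the crux -/

/-- The complexification `ℝ≥0 → ℝ → ℂ` used by the route. -/
abbrev φ : NNReal →+* ℂ := Complex.ofRealHom.comp NNReal.toRealHom

/-- Hypothesis 1 of the crux: invariance under INDEPENDENT row and column permutations. -/
def MatrixSymmetric (f : (n : ℕ) → MvPolynomial (Fin n × Fin n) NNReal) : Prop :=
  ∀ (n : ℕ) (σ τ : Equiv.Perm (Fin n)),
    MvPolynomial.rename (fun p : Fin n × Fin n => (σ p.1, τ p.2)) (f n) = f n

/-- Hypothesis 2 of the crux: polynomial degree AND polynomial monotone complexity. -/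
def PolyMonotone (f : (n : ℕ) → MvPolynomial (Fin n × Fin n) NNReal) : Prop :=
  ∃ c : ℕ, ∀ n : ℕ, (f n).totalDegree ≤ (n + 2) ^ c ∧ complexity (k := NNReal) (f n) ≤ (n + 2) ^ c

/-- Hypothesis 2 with the complexity clause dropped: polynomial degree only. -/
def PolyDegree (f : (n : ℕ) → MvPolynomial (Fin n × Fin n) NNReal) : Prop :=
  ∃ c : ℕ, ∀ n : ℕ, (f n).totalDegree ≤ (n + 2) ^ c

/-- The conclusion of the crux: quasi-polynomial square-symmetric circuits over `ℂ`. -/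
def QPSymmetric (f : (n : ℕ) → MvPolynomial (Fin n × Fin n) NNReal) : Prop :=
  ∃ c : ℕ, ∀ n : ℕ, ∃ (G : Type) (_ : Fintype G)
    (C : LabelledArithCircuit ℂ (Fin n × Fin n) Unit G),
    C.IsSymmetric (Equiv.Perm (Fin n)) ∧ C.eval (C.output ()) = MvPolynomial.map φ (f n) ∧
      Fintype.card G ≤ 2 ^ ((Nat.log 2 n + c) ^ c)

/-- The crux, literally, is `MatrixSymmetric → PolyMonotone → QPSymmetric`. -/
theorem monotoneRestorationQP_iff :
    MonotoneRestorationQP ↔ ∀ f, MatrixSymmetric f → PolyMonotone f → QPSymmetric f :=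
  Iff.rfl

/-! ### (a) Load-bearing analysis, 1: the monotone-complexity bound

Dropping it leaves "every matrix-symmetric family of polynomial degree has quasi-polynomial
square-symmetric circuits", refuted by the permanent (Dawar–Wilsenach 2025, Thm 7.1). -/

/-- The crux WITHOUT the monotone-complexity clause. -/
def MonotoneRestorationQPWithoutComplexity : Prop :=
  ∀ f, MatrixSymmetric f → PolyDegree f → QPSymmetric f

/-- The nonnegative permanent is matrix-symmetric (any commutative semiring). -/
theorem matrixSymmetric_perPoly : MatrixSymmetric fun n => perPoly (Fin n) NNReal := by
  intro n σ τ
  have h1 : MvPolynomial.rename (fun p : Fin n × Fin n => (σ p.1, τ p.2))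
      (perPoly (Fin n) NNReal) =
      ((Matrix.mvPolynomialX (Fin n) (Fin n) NNReal).submatrix σ τ).permanent := by
    simp only [perPoly, Matrix.permanent, map_sum, map_prod, Matrix.mvPolynomialX_apply,
      MvPolynomial.rename_X, Matrix.submatrix_apply]
  rw [h1]
  have h2 : ((Matrix.mvPolynomialX (Fin n) (Fin n) NNReal).submatrix (σ : Fin n → Fin n)
      (τ : Fin n → Fin n)) =
      (((Matrix.mvPolynomialX (Fin n) (Fin n) NNReal).submatrix id (τ : Fin n → Fin n)).submatrix
        (σ : Fin n → Fin n) id) := by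
    ext i j; simp
  rw [h2, Matrix.permanent_permute_cols, Matrix.permanent_permute_rows]
  rfl

/-- The permanent has polynomial degree (`deg per_n = n ≤ n + 2`). -/
theorem polyDegree_perPoly : PolyDegree fun n => perPoly (Fin n) NNReal := by
  refine ⟨1, fun n => ?_⟩
  calc (perPoly (Fin n) NNReal).totalDegree ≤ Fintype.card (Fin n) :=
        perPoly_isHomogeneous.totalDegree_le
    _ ≤ (n + 2) ^ 1 := by simp

/-- The arithmetic of the route's deciding theorem: `2^((log₂ n + c)^c) < 2^(δ n)` for large `n`. -/
theorem qp_lt_exp (c : ℕ) {δ : ℝ} (hδ : 0 < δ) :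
    ∃ n₀ : ℕ, ∀ n : ℕ, n₀ ≤ n → ((Nat.log 2 n + c) ^ c : ℝ) < δ * n := by
  have hlim : Filter.Tendsto (fun k : ℕ => (k : ℝ) ^ c / (2 : ℝ) ^ k) Filter.atTop (nhds 0) :=
    tendsto_pow_const_div_const_pow_of_one_lt c one_lt_two
  have hδ' : 0 < δ / 2 ^ c := by positivity
  obtain ⟨k₁, hk₁⟩ := Filter.eventually_atTop.1 (hlim.eventually (gt_mem_nhds hδ'))
  refine ⟨2 ^ max k₁ c, fun n hn => ?_⟩
  set k₀ : ℕ := max k₁ c with hk₀def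
  have hn0 : n ≠ 0 := by
    have : 0 < 2 ^ k₀ := Nat.two_pow_pos _
    omega
  set k := Nat.log 2 n with hkdef
  have hk : k₀ ≤ k := by
    rw [hkdef]
    calc k₀ = Nat.log 2 (2 ^ k₀) := (Nat.log_pow Nat.one_lt_two _).symm
      _ ≤ Nat.log 2 n := Nat.log_mono_right hn
  have hkc : c ≤ k := le_trans (le_max_right _ _) hk
  have hk1 : k₁ ≤ k := le_trans (le_max_left _ _) hk
  have hA : ((k + c) ^ c : ℝ) ≤ (2 : ℝ) ^ c * (k : ℝ) ^ c := by
    have : (k + c : ℝ) ≤ 2 * k := by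
      have : (c : ℝ) ≤ k := by exact_mod_cast hkc
      linarith
    calc ((k + c) ^ c : ℝ) ≤ (2 * (k : ℝ)) ^ c := by
          exact pow_le_pow_left₀ (by positivity) this c
      _ = (2 : ℝ) ^ c * (k : ℝ) ^ c := by rw [mul_pow]
  have hB : (k : ℝ) ^ c < δ / 2 ^ c * (2 : ℝ) ^ k := by
    have h := hk₁ k hk1
    have h2k : (0 : ℝ) < (2 : ℝ) ^ k := by positivity
    rwa [div_lt_iff₀ h2k] at h
  have hC : ((2 : ℝ) ^ k : ℝ) ≤ n := by
    have := Nat.pow_log_le_self 2 hn0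
    rw [← hkdef] at this
    exact_mod_cast this
  have h2c : (0 : ℝ) < (2 : ℝ) ^ c := by positivity
  calc ((Nat.log 2 n + c) ^ c : ℝ) = ((k + c) ^ c : ℝ) := by rw [hkdef]
    _ ≤ (2 : ℝ) ^ c * (k : ℝ) ^ c := hA
    _ < (2 : ℝ) ^ c * (δ / 2 ^ c * (2 : ℝ) ^ k) := by
        exact mul_lt_mul_of_pos_left hB h2c
    _ = δ * (2 : ℝ) ^ k := by field_simp
    _ ≤ δ * n := by exact mul_le_mul_of_nonneg_left hC hδ.le

/-- **The permanent has no quasi-polynomial square-symmetric circuits** (Dawar–Wilsenach 2025,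
Thm 7.1, size form, proved in the tree) — the conclusion of the crux fails at `f = per`. -/
theorem not_qpSymmetric_perPoly : ¬ QPSymmetric fun n => perPoly (Fin n) NNReal := by
  rintro ⟨c, hc⟩
  classical
  choose G inst C hCsymm hCeval hCcard using hc
  have hper : ∀ n, (C n).eval ((C n).output ()) = perPoly (Fin n) ℂ := fun n => by
    rw [hCeval n]; exact map_perPoly _
  obtain ⟨δ, hδ, hio⟩ :=
    @DawarWilsenach2025_thm71.size_form DawarWilsenach2025_thm71_holds ℂ _ _ G inst C hCsymm hper
  obtain ⟨n₀, key⟩ := qp_lt_exp c hδ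
  obtain ⟨n, hn, hle⟩ := hio n₀
  have hcard : (Fintype.card (G n) : ℝ) ≤ (2 : ℝ) ^ (((Nat.log 2 n + c) ^ c : ℕ) : ℝ) := by
    rw [Real.rpow_natCast]
    exact_mod_cast hCcard n
  have hlt : (2 : ℝ) ^ (((Nat.log 2 n + c) ^ c : ℕ) : ℝ) < (2 : ℝ) ^ (δ * n) := by
    apply (Real.rpow_lt_rpow_left_iff one_lt_two).2
    have := key n hn
    push_cast at this ⊢
    exact this
  exact absurd (hle.trans hcard) (not_le.mpr hlt)

/-- **(a1) Any proof must use the monotone-complexity bound**: the crux with that clause dropped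
is false (witness: the nonnegative permanent; Dawar–Wilsenach 2025 Thm 7.1). -/
theorem monotoneRestorationQP_false_without_complexity : ¬ MonotoneRestorationQPWithoutComplexity :=
  fun h => not_qpSymmetric_perPoly (h _ matrixSymmetric_perPoly polyDegree_perPoly)

/-! ### (a) Load-bearing analysis, 2: matrix symmetry

A square-symmetric circuit computes a DIAGONALLY invariant polynomial, so without an invariance
hypothesis the crux fails at a single off-diagonal variable. -/

/-- The crux WITHOUT the invariance hypothesis. -/
def MonotoneRestorationQPWithoutInvariance : Prop :=
  ∀ f, PolyMonotone f → QPSymmetric f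

/-- The conclusion of the crux forces diagonal invariance of (the complexification of) `f n`. -/
theorem QPSymmetric.rename_diag {f : (n : ℕ) → MvPolynomial (Fin n × Fin n) NNReal}
    (h : QPSymmetric f) (n : ℕ) (σ : Equiv.Perm (Fin n)) :
    MvPolynomial.rename (fun x : Fin n × Fin n => σ • x) (MvPolynomial.map φ (f n)) =
      MvPolynomial.map φ (f n) := by
  obtain ⟨c, hc⟩ := h
  obtain ⟨G, _, C, hsymm, heval, -⟩ := hc n
  rw [← heval]
  exact hsymm.rename_eval_output_unit σ

/-- The off-diagonal variable `x₀₁` (and `0` below `n = 2`). -/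
def offDiag (n : ℕ) : MvPolynomial (Fin n × Fin n) NNReal :=
  if h : 2 ≤ n then X (⟨0, by omega⟩, ⟨1, by omega⟩) else 0

theorem offDiag_two : offDiag 2 = X ((0 : Fin 2), (1 : Fin 2)) := by
  simp [offDiag]

/-- `x₀₁` has degree ≤ 1 and monotone complexity `0`. -/
theorem polyMonotone_offDiag : PolyMonotone offDiag := by
  refine ⟨1, fun n => ?_⟩
  unfold offDiag
  split_ifs with h
  · constructor
    · exact (totalDegree_X _).le.trans (by simp)
    · rw [complexity_X_holds]; exact Nat.zero_le _
  · constructor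
    · simp
    · have : complexity (k := NNReal) (0 : MvPolynomial (Fin n × Fin n) NNReal) = 0 := by
        simpa using complexity_C_holds (σ := Fin n × Fin n) (0 : NNReal)
      rw [this]; exact Nat.zero_le _

/-- `x₀₁` is not diagonally invariant: the transposition `(0 1)` sends it to `x₁₀`. -/
theorem not_qpSymmetric_offDiag : ¬ QPSymmetric offDiag := by
  intro h
  have key := h.rename_diag 2 (Equiv.swap (0 : Fin 2) 1)
  rw [offDiag_two, map_X, rename_X] at key
  have hinj := MvPolynomial.X_injective (σ := Fin 2 × Fin 2) (R := ℂ) key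
  simp [Prod.ext_iff] at hinj

/-- **(a2) Any proof must use the invariance hypothesis**: without it the crux fails at `x₀₁`.
The conclusion itself only needs DIAGONAL invariance — see `MonotoneRestorationQPDiag`. -/
theorem monotoneRestorationQP_false_without_invariance : ¬ MonotoneRestorationQPWithoutInvariance :=
  fun h => not_qpSymmetric_offDiag (h _ polyMonotone_offDiag)

/-- SOFT SPOT (stated, open): the crux with invariance weakened to the DIAGONAL action — all that a
square-symmetric circuit guarantees. Strictly stronger than the crux; no counterexample known
(a diagonally-invariant = directed-graph polynomial computed by an order-exploiting monotone DP of
counting width `ω(polylog n)` would refute it and leave the crux open). -/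
def MonotoneRestorationQPDiag : Prop :=
  ∀ f : (n : ℕ) → MvPolynomial (Fin n × Fin n) NNReal,
    (∀ (n : ℕ) (σ : Equiv.Perm (Fin n)), MvPolynomial.rename (fun x : Fin n × Fin n => σ • x) (f n) = f n) →
    PolyMonotone f → QPSymmetric f

/-- The diagonal form implies the crux (matrix symmetry ⇒ diagonal symmetry). -/
theorem monotoneRestorationQP_of_diag (h : MonotoneRestorationQPDiag) : MonotoneRestorationQP := by
  intro f hf hmono
  exact h f (fun n σ => hf n σ σ) hmono


/-! ### (c) A natural strengthening refuted: ONE exponent for all families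

`MonotoneRestorationQPUniform` swaps `∀ f … ∃ c'` into `∃ c' ∀ f`. It is FALSE already at `n = 1`
(where symmetry is vacuous): a labelled circuit with `s` gates computes a polynomial of degree
`≤ s ^ s` (`totalDegree_eval_le`, children are SETS so degree is at most multiplied by the fan-in
`≤ s` per level), while `(Σ x_ij)^(3^c)` has monotone complexity `≤ 3^c (n² + 1)` by iterated
cubing. Information for provers: the symmetric exponent `c'` must grow with the monotone
exponent `c` (here: forced by degree alone). -/

section DegreeGrowth

variable {K : Type*} {X Y G : Type*} [Fintype G] (C : LabelledArithCircuit K X Y G)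

/-- The strict descendants of a gate (gates reachable by following wires downwards). -/
def desc (g : G) : Finset G := by
  classical exact Finset.univ.filter fun h => Relation.TransGen (fun a b => a ∈ C.children b) h g

theorem mem_desc {g h : G} :
    h ∈ desc C g ↔ Relation.TransGen (fun a b => a ∈ C.children b) h g := by
  classical simp [desc]

theorem desc_subset_of_mem_children {g h : G} (hh : h ∈ C.children g) : desc C h ⊆ desc C g := by
  intro x hx
  rw [mem_desc] at hx ⊢
  exact hx.tail hh

theorem mem_desc_of_mem_children {g h : G} (hh : h ∈ C.children g) : h ∈ desc C g := by
  rw [mem_desc]; exact Relation.TransGen.single hh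

theorem not_mem_desc_self (g : G) : g ∉ desc C g := by
  rw [mem_desc]
  exact fun h => C.wf.transGen.asymmetric g g h h

theorem card_desc_lt_of_mem_children {g h : G} (hh : h ∈ C.children g) :
    (desc C h).card < (desc C g).card := by
  apply Finset.card_lt_card
  refine ⟨desc_subset_of_mem_children C hh, fun hsub => ?_⟩
  exact not_mem_desc_self C h (hsub (mem_desc_of_mem_children C hh))

variable [CommSemiring K]

/-- **Degree growth in a labelled circuit**: the polynomial at a gate `g` has total degree at most
`|G| ^ (number of strict descendants of g)` — an input has degree `≤ 1`, a sum does not raise the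
degree, a product gate has at most `|G|` children, each with fewer descendants. [folklore] -/
theorem totalDegree_eval_le_pow_card_desc (g : G) :
    (C.eval g).totalDegree ≤ Fintype.card G ^ (desc C g).card := by
  induction g using C.wf.induction with
  | h g ih =>
    have hs : 1 ≤ Fintype.card G := Fintype.card_pos_iff.2 ⟨g⟩
    rcases hl : C.label g with x | c | _ | _
    · rw [C.eval_of_label_var hl]
      exact (isHomogeneous_X K x).totalDegree_le.trans (Nat.one_le_pow _ _ hs)
    · rw [C.eval_of_label_const hl]; simp
    · rw [C.eval_of_label_add hl]
      refine (totalDegree_finsetSum _ _).trans (Finset.sup_le fun h hh => ?_)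
      exact (ih h hh).trans (Nat.pow_le_pow_right hs (card_desc_lt_of_mem_children C hh).le)
    · rw [C.eval_of_label_mul hl]
      have hne : (C.children g).Nonempty := by
        rw [Finset.nonempty_iff_ne_empty, Ne, ← C.isInput_iff, hl]
        exact CircuitLabel.not_isInput_mul
      obtain ⟨h₀, hh₀⟩ := hne
      have hpos : 1 ≤ (desc C g).card :=
        Finset.card_pos.2 ⟨h₀, mem_desc_of_mem_children C hh₀⟩
      calc (∏ h ∈ C.children g, C.eval h).totalDegree
          ≤ ∑ h ∈ C.children g, (C.eval h).totalDegree := totalDegree_finsetProd _ _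
        _ ≤ ∑ h ∈ C.children g, Fintype.card G ^ ((desc C g).card - 1) :=
            Finset.sum_le_sum fun h hh => (ih h hh).trans
              (Nat.pow_le_pow_right hs (by have := card_desc_lt_of_mem_children C hh; omega))
        _ = (C.children g).card * Fintype.card G ^ ((desc C g).card - 1) := by simp
        _ ≤ Fintype.card G * Fintype.card G ^ ((desc C g).card - 1) :=
            Nat.mul_le_mul_right _ (Finset.card_le_univ _)
        _ = Fintype.card G ^ (desc C g).card := by
            rw [← pow_succ']; congr 1; omega

/-- **Degree growth, size form**: a labelled circuit with `s` gates computes polynomials of total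
degree at most `s ^ s`. [folklore] -/
theorem totalDegree_eval_le (g : G) :
    (C.eval g).totalDegree ≤ Fintype.card G ^ Fintype.card G := by
  have hs : 1 ≤ Fintype.card G := Fintype.card_pos_iff.2 ⟨g⟩
  exact (totalDegree_eval_le_pow_card_desc C g).trans
    (Nat.pow_le_pow_right hs (Finset.card_le_univ _))

end DegreeGrowth

/-- The strengthening with ONE symmetric exponent `c'` serving every family. -/
def MonotoneRestorationQPUniform : Prop :=
  ∃ c' : ℕ, ∀ f : (n : ℕ) → MvPolynomial (Fin n × Fin n) NNReal,
    MatrixSymmetric f → PolyMonotone f →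
    ∀ n : ℕ, ∃ (G : Type) (_ : Fintype G) (C : LabelledArithCircuit ℂ (Fin n × Fin n) Unit G),
      C.IsSymmetric (Equiv.Perm (Fin n)) ∧ C.eval (C.output ()) = MvPolynomial.map φ (f n) ∧
        Fintype.card G ≤ 2 ^ ((Nat.log 2 n + c') ^ c')

/-- The uniform form implies the crux (so refuting it does not touch the crux). -/
theorem monotoneRestorationQP_of_uniform (h : MonotoneRestorationQPUniform) :
    MonotoneRestorationQP := by
  obtain ⟨c', hc'⟩ := h
  exact fun f hf hmono => ⟨c', hc' f hf hmono⟩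

/-- The witness family: `(Σ_ij x_ij)^(3^c)`. -/
def powSum (c n : ℕ) : MvPolynomial (Fin n × Fin n) NNReal :=
  (∑ p : Fin n × Fin n, X p) ^ (3 ^ c)

theorem matrixSymmetric_powSum (c : ℕ) : MatrixSymmetric (powSum c) := by
  intro n σ τ
  simp only [powSum, map_pow, map_sum, rename_X]
  congr 1
  exact Equiv.sum_comp (Equiv.prodCongr σ τ) (fun p : Fin n × Fin n => (X p : MvPolynomial _ NNReal))

/-- Monotone complexity of the witness: `L((Σ x)^(3^t)) + 1 ≤ 3^t (n² + 1)` by iterated cubing. -/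
theorem complexity_powSum_succ_le (t n : ℕ) :
    complexity (k := NNReal) (powSum t n) + 1 ≤ 3 ^ t * (n * n + 1) := by
  induction t with
  | zero =>
    have h := complexity_finset_sum_le (k := NNReal) (Finset.univ : Finset (Fin n × Fin n))
      (fun p => (X p : MvPolynomial (Fin n × Fin n) NNReal))
    have hX : ∀ p : Fin n × Fin n, complexity (X p : MvPolynomial (Fin n × Fin n) NNReal) = 0 :=
      complexity_X_holds
    simp only [hX, Finset.sum_const_zero, zero_add, Finset.card_univ, Fintype.card_prod,
      Fintype.card_fin] at h
    simpa [powSum] using h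
  | succ t ih =>
    have hmul := complexity_mul_le_holds (k := NNReal) (σ := Fin n × Fin n)
    have h3 : powSum (t + 1) n = powSum t n * powSum t n * powSum t n := by
      rw [powSum, powSum, pow_succ, pow_mul]; ring
    rw [h3]
    calc complexity (powSum t n * powSum t n * powSum t n) + 1
        ≤ (complexity (powSum t n * powSum t n) + complexity (powSum t n) + 1) + 1 := by
          gcongr; exact hmul _ _
      _ ≤ ((complexity (powSum t n) + complexity (powSum t n) + 1) +
            complexity (powSum t n) + 1) + 1 := by
          gcongr; exact hmul _ _
      _ = 3 * (complexity (k := NNReal) (powSum t n) + 1) := by ring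
      _ ≤ 3 * (3 ^ t * (n * n + 1)) := Nat.mul_le_mul_left 3 ih
      _ = 3 ^ (t + 1) * (n * n + 1) := by ring

/-- The witness has polynomial degree and monotone complexity (exponent `2c + 2`). -/
theorem polyMonotone_powSum (c : ℕ) : PolyMonotone (powSum c) := by
  refine ⟨2 * c + 2, fun n => ?_⟩
  have h3 : 3 ^ c ≤ (n + 2) ^ (2 * c) := by
    rw [pow_mul]
    refine Nat.pow_le_pow_left ?_ c
    have : (n + 2) ^ 2 = n * n + 4 * n + 4 := by ring
    omega
  have hsq : n * n + 1 ≤ (n + 2) ^ 2 := by nlinarith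
  constructor
  · calc (powSum c n).totalDegree ≤ 3 ^ c * (∑ p : Fin n × Fin n, X p).totalDegree :=
          totalDegree_pow _ _
      _ ≤ 3 ^ c * 1 := by
          gcongr
          refine (totalDegree_finsetSum _ _).trans (Finset.sup_le fun p _ => ?_)
          exact (isHomogeneous_X NNReal p).totalDegree_le
      _ ≤ (n + 2) ^ (2 * c) * (n + 2) ^ 2 := by
          rw [mul_one]
          exact le_mul_of_le_of_one_le h3 (Nat.one_le_pow _ _ (by omega))
      _ = (n + 2) ^ (2 * c + 2) := by rw [← pow_add]
  · have h := complexity_powSum_succ_le c n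
    calc complexity (powSum c n) ≤ 3 ^ c * (n * n + 1) := by omega
      _ ≤ (n + 2) ^ (2 * c) * (n + 2) ^ 2 := Nat.mul_le_mul h3 hsq
      _ = (n + 2) ^ (2 * c + 2) := by rw [← pow_add]

/-- At `n = 1` the complexified witness is `x₀₀ ^ (3^c)`, of degree `3^c`. -/
theorem totalDegree_map_powSum_one (c : ℕ) :
    (MvPolynomial.map φ (powSum c 1)).totalDegree = 3 ^ c := by
  simp only [powSum, map_pow, map_sum, map_X]
  rw [Fintype.sum_subsingleton _ ((0 : Fin 1), (0 : Fin 1))]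
  exact totalDegree_X_pow (R := ℂ) _ _

/-- **(c1) The uniform strengthening is false**: given `c'`, take `c = S·S` with
`S = 2^(c'^c')`; at `n = 1` a circuit of size `s ≤ S` has degree `≤ s^s ≤ S^S < 3^(S·S)`. -/
theorem not_monotoneRestorationQPUniform : ¬ MonotoneRestorationQPUniform := by
  rintro ⟨c', h⟩
  set S : ℕ := 2 ^ (c' ^ c') with hS
  obtain ⟨G, inst, C, -, heval, hcard⟩ :=
    h (powSum (S * S)) (matrixSymmetric_powSum _) (polyMonotone_powSum _) 1
  have hdeg := totalDegree_eval_le C (C.output ())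
  rw [heval, totalDegree_map_powSum_one] at hdeg
  have hcard' : Fintype.card G ≤ S := by simpa [hS] using hcard
  have hs : 1 ≤ Fintype.card G := Fintype.card_pos_iff.2 ⟨C.output ()⟩
  have hS1 : 1 ≤ S := Nat.one_le_two_pow
  have h1 : Fintype.card G ^ Fintype.card G ≤ S ^ S :=
    (Nat.pow_le_pow_left hcard' _).trans (Nat.pow_le_pow_right hS1 hcard')
  have h2 : S ^ S < 3 ^ (S * S) := by
    rw [pow_mul]
    exact Nat.pow_lt_pow_left (Nat.lt_pow_self (by norm_num)) (by omega)
  omega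


/-! ### Non-vacuity and sanity -/

/-- The hypotheses of the crux are jointly satisfiable by a non-trivial family (so (a1)/(a2) are
not artefacts of an empty hypothesis class): `(Σ x_ij)^(3^c)` is matrix-symmetric, of polynomial
degree and polynomial monotone complexity. -/
theorem hypotheses_satisfiable (c : ℕ) : MatrixSymmetric (powSum c) ∧ PolyMonotone (powSum c) :=
  ⟨matrixSymmetric_powSum c, polyMonotone_powSum c⟩

/-! ### Why the crux resists (cycle 1) -/

/-- **WHY `MonotoneRestorationQP` RESISTS** (no kill in cycle 1; numbers, then reasons).

LANDED (tree, `Theorems/MonotoneRestorationQP/Negative/`): `LoadBearing.lean` (p129549: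
`monotoneRestorationQP_false_without_complexity`, `monotoneRestorationQP_false_without_invariance`,
`not_qpSymmetric_perPoly`, `polylog_pow_lt_linear`), `UniformExponentFalse.lean` (p129604:
`monotoneRestorationQP_uniform_false`, `totalDegree_eval_le`).

THE ONLY ROAD TO `¬ crux` in the tree is Dawar–Wilsenach: a matrix-symmetric, monotone-poly family
whose COUNTING WIDTH is `ω(polylog n)` (then Thm 6.4 = `DawarWilsenach2025_orbitSize_countingWidth_holds`
forces symmetric size `n^{ω(polylog)}`); the only C^k-inequivalent-but-hard pairs in the tree are
the CFI matching graphs of Thm 7.2 (`CFIMatchingGraphs`), separated by `#PM` — monotone-HARD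
(Jerrum–Snir 1982 §4.3: `per_n` needs `n(2^{n-1}-1)` multiplications).

CANDIDATE FAMILIES RUN (paper; all restore or leave the hypothesis class):
* read-once ROW DPs `f = λᵀ M₁(row 1) ⋯ Mₙ(row n) γ` of poly width (e_k of row products/sums,
  "rectangular permanents" with `log n` roles, nested aggregates): DEAD as a source — row
  invariance of the OUTPUT makes the minimal (Schützenberger–Fliess) realisation COMMUTING
  (`λ N_u [N_r, N_r'] N_v γ = 0` + reachability/observability), of width ≤ n·width; a product of
  `n` elements of a poly-dimensional COMMUTATIVE algebra is symmetric-poly over `ℂ` by Newton's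
  identities inside the algebra (power sums `Σ_i a_i^j` are canonical gates); column symmetry acts
  linearly on the canonical realisation, and an `S_n`-module of dimension `< C(n,k)` embeds in the
  permutation module on `k`-tuples (Rasala / Ellis–Friedgut–Pilpel level lemmas), giving permuted
  gate sets with poly orbits. (This is crux card B's territory; recorded here as the reason the
  planner's "order-exploiting DP" why-might-fail does not materialise for read-once row order.)
* Jastrow/codegree products `Π_{i<i'} (1 + ⟨row_i,row_i'⟩)`, `tr((XXᵀ)^m)`, `Σ_j Π_i (1+x_ij)`,
  `e_k(row sums)` (= Möbius combination of star-forest hom polynomials): on 0/1 matrices these are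
  functions of the C²/C³ type (degree multiset, 2-WL pair colours) ⇒ counting width ≤ 3.
  Sanity table (local, `scratch/srg_pair.py`, SRG(16,6,2,2) pair rook(4×4) vs Shrikhande, a
  C³-equivalent pair): all seven suspects EQUAL (and, incidentally, `per` equal too: 7114752).
* hom polynomials of GROWING patterns of treewidth `t(n) = ω(polylog)`: would refute (DPS25 Thm 1.1
  / DW 6.4) but are monotone-superpoly (`n^{t+1}` for fixed patterns, KomarathPandeyRahul2020
  Thm 1; transfer over multisets costs `C(n+t-1,t)` states) — outside the hypothesis.
* `k`-matchings: monotone-poly only for `k = O(1)` (prefix DP `n^{k+1}`), counting width `O(k)`.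
* Boolean shadow: the known isomorphism-invariant functions of LARGE counting width — CFI / 3XOR
  unsatisfiability / rank mod p — are monotone-HARD where monotone at all (Göös–Kamath–Robere–
  Sokolov 2019 Thm 1: `XOR-SAT_n` needs monotone circuits `2^{n^{Ω(1)}}`); invariant monotone-P
  properties we could list (hypergraph reachability / Horn, 2XOR-UNSAT via double-cover
  reachability, k-clique for constant k, LP-type) all sit in FPC. No printed statement either way
  ("invariant mP ⊆ polylog counting width" is open; lit search degraded this session: searchd down,
  OpenAlex 429, arXiv 2 hits = DPS25/DPS26 already read by the planner).

SOFT SPOTS for the next cycle / for provers: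
1. `MonotoneRestorationQPDiag` (invariance only under the diagonal action): strictly stronger,
   equally natural, and the place where ORDER could matter (row index = column index lets a
   monotone DP correlate row `i` with column `i`); no candidate found yet.
2. General (non-read-once) monotone circuits: VSBR gives monotone formulas of size `n^{O(log d)}`
   with balanced product gates, but NOT a row-read-once structure; a restoration proof must handle
   gates whose polynomials are invariant under NO large subgroup (supports of size Θ(n)) — the
   minimal-realisation trick above does not apply to them. A counterexample, if any, lives there.
3. The degree clause is believed droppable (repeated squaring is symmetric-simulable with copy
   gates `add {g}`); the nonnegativity (semiring `ℝ≥0`) is essential to the ROUTE (Hrubeš bridge)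
   but its role in the CRUX is only to forbid cancellations — dropping it gives PCS.RestorationQP
   for `S_n × S_n`-invariant families (open, DwivediPagoSeppelt2026 Outlook Q3). -/
theorem resists : True := trivial

end

end Summit.ValiantsHypothesis.ValiantsHypothesis.Cruxes.MonotoneRestorationQP.Disproof
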